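import Summits.Ventures.PercRepro.ProfileTwoHall
import Summits.Ventures.PercRepro.HallDisjointPairs

/-!
# PercRepro — THE BASE CASE OF THE HALL ROW IS HALL'S CONDITION FOR DISJOINTNESS ON THE CO-INDEPENDENT PAIRS
(p10, gen 4; `proofs/P10-HALLROW.md` §4(c)–§5)

On a simple matroid with `u + 2` elements the demand of a pair `B` at level `u` is `C(u,2)` if `E ∖ B` is
independent and `0` otherwise (`demand_of_card_eq`), and the independent `u`-sets are exactly the complements
`E ∖ C` of the pairs `C` with independent complement (`coIndepPairs`); `E ∖ C ⊇ B` iff `B ∩ C = ∅`.  So the base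
case `HallBase α u` of the Hall induction (ProfileTwoHall) is EXACTLY Hall's condition for the «disjointness»
relation on `coIndepPairs N`, for every simple `N` on `u + 2` elements:

* `coIndepPairs` — the pairs with independent complement;
* `sum_demand_of_card_eq` — the demand of a family on `u + 2` elements;
* `card_nbr_le_card_indepShadow` — `C ↦ E ∖ C` injects the members disjoint from some member of `𝒜` into the
  independent shadow of `𝒜`;
* **`hallBase_of_hall_disjoint`** — Hall for disjointness on `coIndepPairs N` (every simple `N` on `u + 2`
  elements) gives `HallBase α u`.

What remains for the unconditional Hall row (P10-HALLROW.md §5): Hall for disjointness on `coIndepPairs N`, which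
`HallDisjointPairs.hall_disjoint_pairs` gives from (G1)–(G3) — true for every simple `N` on `u + 2` elements of
nullity `≤ 2` outside finitely many configurations (P10-HALLROW.md §5), where it is a finite check.  Neither
verification is here.
-/

open scoped Matroid

namespace PercRepro.Cogirth

open Finset ThmH Skew Shadow Profile HallDisjoint

variable {α : Type} [DecidableEq α] {M : Matroid α} [M.Finite]

open Classical in
/-- The pairs whose complement is independent. -/
noncomputable def coIndepPairs (M : Matroid α) [M.Finite] : Finset (Finset α) :=
  (indepSets M 2).filter (fun C => M.Indep ((gr M \ C : Finset α) : Set α))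

open Classical in
/-- Membership in `coIndepPairs`. -/
theorem mem_coIndepPairs {C : Finset α} :
    C ∈ coIndepPairs M ↔ C ∈ indepSets M 2 ∧ M.Indep ((gr M \ C : Finset α) : Set α) := by
  unfold coIndepPairs
  rw [mem_filter]

open Classical in
/-- On `u + 2` elements the demand of a family of pairs is `C(u,2)` times the number of its members with
independent complement. -/
theorem sum_demand_of_card_eq {u : ℕ} (hn : (gr M).card = u + 2) (hu : 2 ≤ u) {𝒜 : Finset (Finset α)}
    (h𝒜 : 𝒜 ⊆ indepSets M 2) :
    ∑ B ∈ 𝒜, demand M 2 u B =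
      u.choose 2 * (𝒜.filter (fun B => M.Indep ((gr M \ B : Finset α) : Set α))).card := by
  rw [sum_congr rfl (fun B hB => demand_of_card_eq hn hu (h𝒜 hB)), ← sum_filter, sum_const, smul_eq_mul,
    mul_comm]

/-- `C ↦ E ∖ C` injects the co-independent pairs disjoint from some member of `𝒜` into the independent shadow of
`𝒜` (on `u + 2` elements). -/
theorem card_nbr_le_card_indepShadow {u : ℕ} (hn : (gr M).card = u + 2) {𝒜 : Finset (Finset α)}
    (h𝒜 : 𝒜 ⊆ coIndepPairs M) :
    (nbr (coIndepPairs M) 𝒜).card ≤ (indepShadow M u 𝒜).card := by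
  apply card_le_card_of_injOn (fun C => gr M \ C)
  · intro C hC
    rw [Finset.mem_coe] at hC
    unfold nbr at hC
    rw [mem_filter] at hC
    obtain ⟨hC𝒞, B, hB, hBC⟩ := hC
    rw [mem_coIndepPairs, mem_indepSets] at hC𝒞
    rw [Finset.mem_coe, mem_indepShadow, mem_indepSets]
    refine ⟨⟨sdiff_subset, ?_, hC𝒞.2⟩, B, hB, ?_⟩
    · rw [card_sdiff_of_subset hC𝒞.1.1, hC𝒞.1.2.1, hn]
      omega
    · intro x hx
      rw [mem_sdiff]
      exact ⟨(mem_indepSets.1 (mem_coIndepPairs.1 (h𝒜 hB)).1).1 hx, fun hxC => disjoint_left.1 hBC hx hxC⟩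
  · intro C hC C' hC' h
    rw [Finset.mem_coe] at hC hC'
    unfold nbr at hC hC'
    rw [mem_filter] at hC hC'
    have h1 : C ⊆ gr M := (mem_indepSets.1 (mem_coIndepPairs.1 hC.1).1).1
    have h2 : C' ⊆ gr M := (mem_indepSets.1 (mem_coIndepPairs.1 hC'.1).1).1
    have h3 : gr M \ (gr M \ C) = gr M \ (gr M \ C') := by
      simp only at h
      rw [h]
    rwa [Finset.sdiff_sdiff_eq_self h1, Finset.sdiff_sdiff_eq_self h2] at h3

/-- **The base case of the Hall row is Hall's condition for disjointness on the co-independent pairs**: if for every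
simple matroid `N` on `u + 2` elements and every `𝒜 ⊆ coIndepPairs N` at least `#𝒜` co-independent pairs are
disjoint from some member of `𝒜`, then `HallBase α u`. -/
theorem hallBase_of_hall_disjoint {u : ℕ} (hu : 2 ≤ u)
    (hhall : ∀ (N : Matroid α) [N.Finite], Simple' N → (gr N).card = u + 2 →
      ∀ 𝒜 ⊆ coIndepPairs N, 𝒜.card ≤ (nbr (coIndepPairs N) 𝒜).card) :
    HallBase α u := by
  classical
  intro N _ hs hn 𝒜 h𝒜
  rw [sum_demand_of_card_eq hn hu h𝒜]
  apply Nat.mul_le_mul_left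
  have h𝒜'C : 𝒜.filter (fun B => N.Indep ((gr N \ B : Finset α) : Set α)) ⊆ coIndepPairs N := by
    intro B hB
    rw [mem_filter] at hB
    rw [mem_coIndepPairs]
    exact ⟨h𝒜 hB.1, hB.2⟩
  calc (𝒜.filter (fun B => N.Indep ((gr N \ B : Finset α) : Set α))).card
      ≤ (nbr (coIndepPairs N) (𝒜.filter (fun B => N.Indep ((gr N \ B : Finset α) : Set α)))).card :=
        hhall N hs hn _ h𝒜'C
    _ ≤ (indepShadow N u (𝒜.filter (fun B => N.Indep ((gr N \ B : Finset α) : Set α)))).card :=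
        card_nbr_le_card_indepShadow hn h𝒜'C
    _ ≤ (indepShadow N u 𝒜).card := by
        apply card_le_card
        intro S hS
        rw [mem_indepShadow] at hS ⊢
        obtain ⟨hS, B, hB, hBS⟩ := hS
        exact ⟨hS, B, (mem_filter.1 hB).1, hBS⟩

/-- Every co-independent pair is a 2-set (the hypothesis `hpair` of `hall_disjoint_pairs`). -/
theorem card_eq_two_of_mem_coIndepPairs {C : Finset α} (hC : C ∈ coIndepPairs M) : C.card = 2 :=
  (mem_indepSets.1 (mem_coIndepPairs.1 hC).1).2.1

/-- **The Hall row for every finite matroid, modulo Hall for disjointness on the co-independent pairs of the simple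
matroids on `u + 2` elements.** -/
theorem hallIneq_two_all_of_hall_disjoint {u : ℕ} (hu : 2 < u)
    (hhall : ∀ (N : Matroid α) [N.Finite], Simple' N → (gr N).card = u + 2 →
      ∀ 𝒜 ⊆ coIndepPairs N, 𝒜.card ≤ (nbr (coIndepPairs N) 𝒜).card)
    (M : Matroid α) [M.Finite] : HallIneq M 2 u :=
  hallIneq_two_all_of_base hu (hallBase_of_hall_disjoint (by omega) hhall) M

end PercRepro.Cogirth
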